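import Mathlib
import HarnessLib
import HarnessLib.Audit
import Summits.QuantumFields.Statement
import Literature.MathematicalPhysics.QuantumFieldTheory.BalabanBanachStep
import HarnessLib.Audit.Status.Attr

/-!
Route: ParabolicTrajectory

DORMANT since 2026-08-26T03:35:55Z (reconciler: no traction for 8.3 d (last activity item-evidence-added at 2026-08-17T19:20:16Z); parked, not closed — `ledger route dormant route-QuantumFields-ParabolicTrajectory --off` to reactivate) — unstaffed, not closed; items shared with open routes are served there. `ledger route dormant <id> --off` reactivates.

# Route ParabolicTrajectory — asymptotic freedom as a parabolic fixed point — the continuum limit of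
lattice Yang–Mills as exponential attraction to Bałaban's centre-unstable curve

It suffices to show X = (A) ∧ (B) ∧ (S), realising card parabolic-renormalised-trajectory (spine;
its UV mechanism is (A),
its declared IR dependence is isolated as (B)).
(A) CONTINUUM LIMIT ON THE TRAJECTORY (UV, the card): for every compact simple G, faithful unitary
lattice representation r
and block factor M ≥ M₀(G, r) there is θ₀ > 0 such that EVERY sequence of Wilson lattice theories
with spacings a_k = M^(−n_k)
which is (o) taken at the asymptotically free fixed point — β_k → ∞, i.e. bare coupling g_k² → 0
(rev 4 repair: excludes
the parasitic tunings at a bulk first-order transition / critical endpoint at finite β for reducible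
r) — (i) non-perturbatively tuned — the dimensionless curvature two-point function N_t(k) :=
a_k^(−8)·⟨P ; τ_(t/a_k) P⟩
(P = Wilson action density = lattice tr F², time direction, on the scheme's torus) converges for
every integer physical
separation t ≥ 1, with limit θ ∈ (0, θ₀) at t = 1 — and (ii) uniformly gapped on the lattice
(HasLatticeMassGap r sch Δ),
admits species renormalisations c_s(k), m_s(k) under which the joint lattice Schwinger functions of
ALL gauge-invariant
local fields converge along the FULL sequence (IsYangMillsFor — existence and uniqueness, no
subsequence) to OS data T on ℝ⁴
(E0, E0', E1–E4) that are non-trivial and non-Gaussian in tr F².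
(B) LATTICE GAP ON THE TRAJECTORY (IR junction, to be shared with the IR cards): every sequence with
β_k → ∞ tuned as in (i) is uniformly
gapped, ∃ Δ > 0 with HasLatticeMassGap, and every continuum limit along it clusters at rate Δ
(T.HasMassGap Δ).
(S) TUNED SEQUENCES WITH β_k → ∞ EXIST for every small θ (compactness + reflection positivity + a
correlator lower bound, the last being open).
Lean: `ContinuumLimitOnTrajectory ∧ LatticeGapOnTrajectory ∧ TunedSequenceExists`

## Assembly
Pure logic, proved sorry-free (`closes`, re-certified at rev 4): fix G; IsCompactSimpleLieGroup G
gives a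
lattice representation r; take M = max(M₀, 2) from (A), θ₀ = min of the windows of (A) and (S), θ =
θ₀/2; (S) gives a tuned
scheme sch with β_k → ∞; (B) gives Δ > 0, HasLatticeMassGap r sch Δ and the gap-transfer clause; (A)
gives sch' (same a, β, L) and T with
IsYangMillsFor, IsNontrivial, IsNonGaussian; the transfer clause gives T.HasMassGap Δ and
HasLatticeMassGap r sch' Δ is
HasLatticeMassGap r sch Δ rewritten along sch'.a = sch.a, sch'.β = sch.β, sch'.L = sch.L. Hence
YangMills.

Rationale: WHY THIS LINE. Asymptotic freedom makes the free fixed point of the block-spin map PARABOLIC: in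
Bałaban's small-field coordinates the
coupling flows as g ↦ g + b₀(G)·log M·g³ + O(g⁴) (eigenvalue exactly 1) while every other
gauge-invariant direction
contracts (Balaban1987RG1, Balaban1988Convergent, Balaban1989LargeFieldII, Dimock2013). The
renormalised trajectory is then
the centre-unstable curve of a parabolic point with contracting complement — an object with an
existence-AND-uniqueness
theorem and exponential attraction of nearby orbits (imported from dynamical systems:
Hirsch–Pugh–Shub pseudo-unstable
manifolds doi:10.1007/BFb0092042, the parabolic parameterisation method
doi:10.3934/dcds.2007.17.835,
doi:10.1016/j.jde.2019.11.100, Gevrey theory doi:10.3934/dcds.2017177); the IR mirror of this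
marginal bookkeeping is a
theorem (BauerschmidtBrydgesSlade2019RG), and Wieczerkowski's programme
(doi:10.1016/s0550-3213(96)00695-5,
arXiv:hep-lat/9809050) defines the trajectory exactly this way but leaves "the domain of attraction
of this extended fixed
point" open. The λ-lemma for the tuned Wilson orbits Rⁿ(Wilson(β_n)) is precisely what Bałaban's
programme lacks: it
upgrades ultraviolet STABILITY (subsequential limits,
Literature.Barriers.QuantumFields.UVStabilityNonUniqueness) to
CONVERGENCE of the full sequence, with the position on the curve fixed by a non-perturbative
renormalisation condition
(dimensional transmutation as a Fatou coordinate). The line splits the Clay statement into a typed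
UV crux conditional on a
typed lattice-gap crux plus a pure Banach-space dynamics theorem, none of which restates the target;
no prior route exists
for YangMills and the negatives index is empty.

RANKED CRUXES. #0 TrajectoryThesis (target) — X = (A) ∧ (B) ∧ (S) as in § Thesis. (why it might
fail: conjunction of an open UV existence-and-uniqueness statement (A) and the infrared lattice mass
gap for tuned Wilson sequences (B); fails if either does.) [JaffeWitten2000, Rivasseau1991,
Balaban1988Convergent]
#2 ContinuumLimitOnTrajectory (crux) — (A) of the thesis — for every compact simple G, lattice
representation r, M ≥ M₀: ∃ θ₀ > 0 such that every M-adic (a_k = M^(−n_k)) Wilson scheme with β_k →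
∞ whose dimensionless curvature two-point functions N_t(k) converge for all t ≥ 1 with lim N_1 = θ ∈
(0, θ₀), and which has HasLatticeMassGap r sch Δ (Δ > 0), admits renormalisations (same a, β, L) and
OS data T with IsYangMillsFor r sch' T, T.IsNontrivial r.curvature, T.IsNonGaussian r.curvature
(card items 1–4: Bałaban step as a C²/Lipschitz parabolic map → centre-unstable curve → λ-lemma →
observable flow). [deps: ParabolicCentreCurve] [difficulty: open-problem] (why it might fail: needs
Bałaban's full step as a Lipschitz map with o(g³) large-field remainder (unknown), E1/E0' for tr F²
limits, and injectivity of the scale setting t ↦ lim N_t; a tuned gapped sequence with two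
accumulation points or an anisotropic limit refutes it.) [Balaban1987RG1, Balaban1988Convergent,
Balaban1989LargeFieldII, Dimock2013, arXiv:hep-lat/9809050, doi:10.1016/s0550-3213(96)00695-5,
GawedzkiKupiainenNegCoupling1985, OsterwalderSeiler1978,
Literature.Barriers.QuantumFields.UVStabilityNonUniqueness]
#4 ParabolicCentreCurve (support since retriage; PROVED, stmt-QuantumFields-9175) — abstract
dynamics (card item 3, typed over Mathlib): on ℝ × E, E a real Banach space, a map F(g, y) = (g + b
g³ + ρ₁, A y + ρ₂) with b > 0, ‖A‖ ≤ θ < 1 and explicit Lipschitz remainder bounds (ρ₁ = O(g⁴ +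
g³‖y‖), ∂_y ρ₁ = O(g³), ρ₂ = O(g² + ‖y‖²), …) has, on some [0, δ'], a continuous invariant graph y =
h(g) with h(0) = 0, ‖h(g)‖ ≤ C'g² (the centre-unstable curve on the repelling side), UNIQUE among
continuous invariant graphs through 0 staying in the chart, and exponentially attracting: every
orbit segment staying in the chart satisfies ‖y_k − h(g_k)‖ ≤ K θ₁^k ‖y_0 − h(g_0)‖ with θ₁ < 1.
[difficulty: L] (why it might fail: pure Banach-space dynamics, believed true; can fail only through
the exact hypotheses — uniqueness among merely continuous graphs, or a chart-boundary edge effect in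
the attraction clause (invariance used at φ(g, h g) slightly beyond δ'); then restate, not close.)
[doi:10.3934/dcds.2007.17.835, doi:10.3934/dcds.2017177, doi:10.1016/j.jde.2019.11.100,
doi:10.1007/BFb0092042, BauerschmidtBrydgesSlade2019RG]
#5 LatticeGapOnTrajectory (crux) — (B) of the thesis — for every compact simple G, r, M ≥ 2, θ > 0
and every M-adic Wilson scheme with β_k → ∞ and lim_k a_k^(−8)⟨P; τ_(1/a_k) P⟩ = θ there is Δ > 0
with HasLatticeMassGap r sch Δ, and every T with IsYangMillsFor r sch' T (sch' = sch up to species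
renormalisations) has T.HasMassGap Δ. The junction with the IR cards (twisted-tube,
finite-size-criterion, curvature-closer); in this line's language: the unstable curve continues as a
heteroclinic orbit into the high-temperature basin of the Haar fixed point. [difficulty:
open-problem] (why it might fail: contains the infrared mass-gap problem for
asymptotically-free-tuned Wilson sequences (no method beyond strong coupling,
OsterwalderSeiler1978); the transfer clause needs clustering constants uniform over smeared products
(spectral-gap form of HasLatticeMassGap).) [OsterwalderSeiler1978, Seiler1982, JaffeWitten2000,
ChatterjeeYMProb2019, GlimmJaffe1987, Literature.Barriers.QuantumFields.PerturbativeInvisibility]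
#9 TunedSequenceExists (crux since retriage; rank 9) — (S) — for every compact simple G, r, M ≥ 2
there is θ₀ > 0 such that for every θ ∈ (0, θ₀) some M-adic Wilson scheme with β_k → ∞ has all
N_t(k) convergent and N_1(k) → θ (diagonal compactness; RP monotonicity t ↦ N_t; continuity in β and
the intermediate value theorem from N_1 = 0 at β = 0; a correlator lower bound sup_β N_1 ≥ θ₀ on
large tori, which is the only non-elementary input — refuters/grounder rate it open: a quantitative
ξ(β) → ∞, Chatterjee Pb 5.1). [difficulty: L/open] [OsterwalderSeiler1978, MontvayMunster1994,
Seiler1982]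

TWO-LAYER PLAN. Rev 5 (route-repair 2026-08-16, unused-crux): the foreseen split
ContinuumLimitOnTrajectory ⇐ BalabanStepParabolic →
ParabolicCentreCurve → ObservableFlowTransfer is WITHDRAWN as an item-level split.
BalabanStepParabolic (stmt-QuantumFields-9684,
`∀ G r, ∃ M₀, ∀ M ≥ M₀, Nonempty (BalabanBanachStep G r M)`) never fed `closes`, and its crux chain
settled, kernel-checked, that the typed
interface cannot be a first layer of (A): every even M ≥ 2 is junk-inhabited
(Theorems.BalabanStepParabolic.Negative.nonempty_of_even,
balabanStepParabolic_iff_odd); at odd M inhabitation is EQUIVALENT to the RG-free over-tuned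
triviality statement UOT(r, M, B) about
Wilson's theory (Negative.nonempty_iff_uniformOverTuned) — silent at the asymptotically-free slope,
so it cannot feed (A); and
FaceContactHypothesis → ¬BalabanStepParabolic
(Negative.balabanStepParabolic_false_of_faceContactHypothesis: (4c) admits periodic face
contact; misstated modulo H). The drefute census reads: no typed first layer of (A) is both
junk-robust and weaker than (A). Hence the item is
RE-BADGED crux → support (not load-bearing; negative-record decl KEPT COMPILED because
EvenRedundant.lean, FaceContact.lean and
ParabolicTrajectoryBalabanStepParabolicRegulatorChartBridge.lean name it — a `--drop` renders it as
a comment and breaks them) and HELD; it is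
never to be re-wanted as a crux, and tenure drops it once those files are retargeted or closes it
`refuted` when H is discharged. The
Bałaban/BBS chart now lives where D-0019 puts proof machinery: as the engine STUB of (A)'s lines
(stub_chart : ChartExists over
TwoOrbitChart in Cruxes/ContinuumLimitOnTrajectory/Lines/two_orbit_synchronisation.lean, the (A)
lead's pick; stub_jacobianCollapse /
stub_flowedFreeEnergyLimit in the rivals), landed with --supports, with ParabolicCentreCurve
(PROVED) as the theorem those stubs consume.
A chart returns as an ITEM only through a glued split of (A) `Chart → Transfer →
ContinuumLimitOnTrajectory` whose Chart demands
NON-TRIVIALITY of the realised data at an accumulation point of Wilson orbits (pins the tuning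
physically), restricts (4c) to tuples
supported in the open fundamental cube, and takes M odd (the tree's tori 2L+1 block only by odd
factors; (A) itself should then read
`Odd M →` — not restated now: a lead holds stmt-QuantumFields-10522). Remaining foreseen splits,
nothing filed: LatticeGapOnTrajectory ⇐ TrajectoryEntersHighTemperature (the continued unstable
curve reaches the convergence
domain of the strong-coupling polymer expansion after finitely many steps — the heteroclinic
connection) → uniform clustering
from the cluster expansion → LatticeGapOnTrajectory (k = 2, for an IR route to own).
TunedSequenceExists ⇐
CorrelatorWindowLowerBound → elementary compactness/RP/IVT glue (k = 2).

KILL CRITERIA. ContinuumLimitOnTrajectory refuted by an explicit tuned, gapped Wilson sequence with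
two continuum accumulation points (or an
anisotropic/non-OS limit) ⇒ close `refuted:ContinuumLimitOnTrajectory` unless the witness abuses a
degenerate species
renormalisation (then restate the species clause once). A documented obstruction showing Bałaban's
R-operation cannot be a
map with Lipschitz control of large-field DIFFERENCES in any quasi-local norm kills the chart stub
of every (A) line (all (A) lines then
die at the chart) ⇒ pivot (A) to a Gevrey-sectorial (non-differentiable, asymptotic-expansion) curve
or close `exhausted`. ParabolicCentreCurve
refuted ⇒ restate hypotheses (never closes the route). LatticeGapOnTrajectory refuted ⇒ the Clay gap
fails for Wilson's
regularisation along tuned sequences — close and hand the witness to the negatives index.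
Existence+uniqueness of the YM₄
continuum limit proved elsewhere moots (A) ⇒ `superseded`.

NOT DECOMPOSED YET. The chart (Bałaban's complete step as a map with orbitwise difference
inequalities and a physical pin) and the observable-flow
transfer, with the one-loop normal form b₀(G) = 11·C₂(G)/(48π²) > 0 uniformly in G — stubs of (A)'s
lines, not items (rev 5);
E1 restoration and E0' growth bounds (inside the transfer child); the Gevrey-1 / Stokes structure of
g ↦ h(g) ("renormalons
as Stokes data", card) — deliberately NOT filed: the summit needs convergence, not summability; the
heteroclinic IR picture
(child of (B), belongs to an IR route); the correlator lower bound behind (S); constants M₀, θ₀, δ'.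

CHEAPEST FALSIFIER. Literature check, one afternoon: in Balaban1988Convergent (CMP 119, Thm 1 p. 262
and §2) and Balaban1989LargeFieldII (CMP 122,
Thm 1), is the (k+1)-st effective density a genuine FUNCTION of the k-th small-field data plus
large-field terms with
REMAINDER BOUNDS, or only a two-sided INEQUALITY after the R-operation? If only inequalities survive
(densities replaced by
bounds), there is no map for ParabolicCentreCurve to act on and the line collapses to "Bałaban +
compactness"
(UVStabilityNonUniqueness). Dimock2013 §1.2–1.3 (scalar re-exposition, small fields only) is the
readable proxy. Second
cheapest: the hierarchical SU(2) gauge model (Timme 1989, DESY 89-110, cited in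
arXiv:hep-lat/9809050) — is its trajectory
the unique attracting centre-unstable curve? Not run by the planner (no kit in plancard mode).

NUMBERS. One loop b₀ = 11N/(48π²) for SU(N) (tree
`Literature.MathematicalPhysics.QuantumLattice.afCoefficient`, convention caveat in
its docstring — which is WHY no typed item pins a slope); two loop b₁ = (N/16π²)²·34/3
(`afCoefficientTwoLoopWith_zero`);
parabolic step g ↦ g + b₀ log M · g³; leading irrelevant contraction M^(−2) (dimension-6 operators);
Bałaban's window
0 < g_k ≤ γ(d, G) (Balaban1987RG1 (0.33)). Items at open: 6 typed (target, 3 cruxes, 1 support,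
assembly) + 1 informal crux. Rev 5: target, 3 cruxes
((A) rank 2, (B) rank 5, (S) rank 9), 2 supports (ParabolicCentreCurve proved; BalabanStepParabolic
held, negative record), proved assembly;
`closes` flat over (A), (B), (S).

DEFINITION REQUESTS. - BalabanBanachStep (posited object, topic
Summits/QuantumFields/YangMills/Theorems, for BalabanStepParabolic): a structure over
  (G, r, M) with a real Banach space E, maps φ : ℝ → E → ℝ, Ψ : ℝ → E → E, A : E →L[ℝ] E and
constants (b, θ, C, δ) satisfying
  the hypothesis block of ParabolicCentreCurve, a Wilson embedding yW : ℝ → E, and a realisation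
functional giving the
  unit-scale smeared n-point functions of the effective theory at (g, y), with the axioms
"realisation ∘ F = realisation
  rescaled by M" and "realisation (g, yW g) = Wilson lattice n-point functions at coupling g";
existence is NOT a field (it is
  the statement BalabanStepParabolic). LANDED as
Literature.MathematicalPhysics.QuantumFieldTheory.BalabanBanachStep; since rev 5 it is the
  vocabulary of the negative record and of (A)'s line charts, its consumer item being held support.
- cite fact wanted (family constructive-qft): Bałaban CMP 119 Thm 1 + Cor. 3 and CMP 122 Thm 1 for
general compact G ⊆ U(N)
  with RG-determined couplings (the tree's `BalabanUVStability4 γ gs` is an SU(2) schematic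
predicate, not a named fact).

DEGENERATE CASES CHECKED. Rev 4 (route-repair 2026-08-15): as first typed, (A), (B), (S) quantified
over ALL faithful unitary r and ALL real
β_k, and the tuning N_1(k) → θ is then met parasitically at FINITE β — on the finite-volume rounding
tail of a bulk first-order
transition (van Enter–Shlosman arXiv:cond-mat/0306362 Thm 2, Wilson's action of SU(n) in r′ =
(1⊕F⊕F̄)^⊗p: fast tori kill
HasLatticeMassGap in (B), slow tori give a two-phase mixture in (A)) or at a Bhanot–Creutz critical
endpoint for reducible r
(doi:10.1103/physrevd.24.3212: tuning and lattice gap hold with diverging physical mass, the limit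
is Gaussian, so (A) fails).
All three now carry `Tendsto sch.β atTop atTop` (bare coupling → 0: the continuum limit is taken at
the asymptotically free
fixed point, which is what the thesis is about); degenerate schemes (β = 0, c = 0, constant n_k)
were already excluded by
N_1 → θ > 0, IsNontrivial/IsNonGaussian and SpeciesScheme.tendsto_a (refuter junk audits g41-8,
g40-0, g41-27, g41-25).
The dropped support item UnitaryGroupNotSimple (U(n) not simple) was a cone artefact, never thesis
content.

Novelty: Searches (2026-08-15): `lit search --hybrid "renormalized trajectory block spin asymptotically free
running coupling invariant
curve fixed point"` (12 hits, textbooks only); `lit search "Wieczerkowski renormalized trajectory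
perturbation theory running
coupling" --source all` (13: arXiv:hep-th/9601142 = doi:10.1016/s0550-3213(96)00695-5,
hep-th/9612226, hep-th/9603005,
doi:10.1023/a:1023028319101, doi:10.1007/bf02179579, doi:10.1142/9789812777874_0007,
arXiv:hep-lat/9809050 — read pp. 3–4, 17, 19);
`lit search --source crossref "Invariant manifolds of parabolic fixed points …"` (8:
doi:10.1016/j.jde.2019.11.100, .099,
doi:10.3934/dcds.2017177, doi:10.3934/dcds.2007.17.835, doi:10.1090/memo/0792); `lit galaxy search
"renormalized trajectory"
--star all` (27 rows: lattice-QCD textbooks on perfect actions, asymptotic safety; nothing rigorous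
for YM₄); `lit frontier
QuantumFields --since 2020` (30: Chatterjee2026YMHiggs arXiv:2401.10507 the nearest rigorous 4-d
non-abelian scaling limit;
arXiv:2606.19362 a non-rigorous claim); `lit bridges QuantumFields --cross any`
(CriticalPhenomena-dominated; the live bridge is
BauerschmidtBrydgesSlade2019RG).
Nearest prior art found: Wieczerkowski 1997–99 (doi:10.1016/s0550-3213(96)00695-5,
doi:10.1023/a:1023028319101,
arXiv:hep-lat/9809050: the trajectory IS an invariant curve in the unstable manifold parametrised by
the running coupling;
hierarchical/perturbative; domain of attraction left open; Timme 1989 hierarchical SU(2));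
GawedzkiKupia  [refs: 10.1016/s0550-3213(96, 10.1023/a:1023028319101, 10.1007/bf02179579, 10.1142/9789812777874_0007, 10.1016/j.jde.2019.11.100, 10.3934/dcds.2017177, 10.3934/dcds.2007.17.835, 10.1090/memo/0792, hep-th/9601142, hep-lat/9809050, 2401.10507, 2606.19362, doi:10.1016/s0550-3213, doi:10.1023/a, doi:10.1007/bf02179579, doi:10.1142/9789812777874_0007, doi:10.1016/j.jde.2019.11.100, doi:10.3934/dcds.2017177, d]

Barriers (technique_class: parabolic-invariant-manifold, renormalised-trajectory): - technique_class: parabolic-invariant-manifold, renormalised-trajectory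
- Literature.Barriers.QuantumFields.UVStabilityNonUniqueness: addressed head-on — conclusions are
drawn from the MAP (contraction transverse to the centre-unstable curve), not from the two-sided
stability certificate `IsUVStable`; ContinuumLimitOnTrajectory asserts `HasCutoffLimit`-type
convergence of the full sequence, exactly what `exists_isUVStable_not_hasCutoffLimit` shows the
certificate cannot give.
- Literature.Barriers.QuantumFields.RegularisationDichotomy: lattice side chosen (reflection
positivity inherited from Wilson's action at every k); Euclidean invariance E1 is recovered in the
limit by evasion (b) — irrelevance of the hypercubic-anisotropy directions along the curve — and
conceded as a named risk inside ContinuumLimitOnTrajectory.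
- Literature.Barriers.QuantumFields.ImprovedActionPositivityViolation: evaded — perfect/effective
actions appear only INSIDE the proof as points of E; every measure whose limit is taken is Wilson's
(RP), so E2 and the transfer matrix come from `wilsonExpectation_reflectionPositive`, never from an
improved action.
- Literature.Barriers.QuantumFields.PerturbativeInvisibility: respected — no mass is computed from
any expansion in g; the gap is the separate crux LatticeGapOnTrajectory, and the tuning is a
non-perturbative renormalisation condition, not asymptotic scaling.
- Literature.Barriers.QuantumFields.InfraredRenormalons: evaded — no Borel–Laplace sum along ℝ

History (route lifecycle, newest last):
- 2026-08-15T14:04:06Z · rev 2: restated TrajectoryThesis (stmt-QuantumFields-9173) — target X was rendered before the crux decls it names (forward reference -> BLOCKED missing decls); restated self-contained as the literal conjunction (A) ∧ (B) (planner-plancard-QuantumFields-YangMills-para-1a2c713a-0)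
- 2026-08-15T16:17:52Z · rev 4: restated ContinuumLimitOnTrajectory (stmt-QuantumFields-9174), LatticeGapOnTrajectory (stmt-QuantumFields-9176), TunedSequenceExists (stmt-QuantumFields-9177), TrajectoryThesis (stmt-QuantumFields-9613) — route-repair g2 (cone): (1) DROP UnitaryGroupNotSimple (stmt-QuantumFields-9774) — not thesis content: under (planner-rrepair-QuantumFields-ParabolicTraject-49702552-g2-0)
- 2026-08-15T16:17:52Z · rev 4: dropped UnitaryGroupNotSimple — route-repair g2 (cone): (1) DROP UnitaryGroupNotSimple (stmt-QuantumFields-9774) — not thesis content: under the constant-level cone audit (#h21_route_deps) Lit (planner-rrepair-QuantumFields-ParabolicTraject-49702552-g2-0)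
- 2026-08-26T03:35:55Z · DORMANT — reconciler: no traction for 8.3 d (last activity item-evidence-added at 2026-08-17T19:20:16Z); parked, not closed — `ledger route dormant route-QuantumFields-Pa (operator:999:2191161)

sub-problem: YangMills · status: dormant · opened planner-plancard-QuantumFields-YangMills-para-1a2c713a-0 2026-08-15T13:51:41Z · rev 7 · ledger route-QuantumFields-ParabolicTrajectory
GENERATED by the gate from the ledger (D-0016/17). Provers cite these decls: `theorem foo : Summit.QuantumFields.YangMills.Theses.ParabolicTrajectory.<Decl> := …` in Summits/QuantumFields/YangMills/Theorems/<Name>.lean.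
-/

namespace Summit.QuantumFields.YangMills.Theses.ParabolicTrajectory

open scoped BigOperators Topology Manifold Classical MeasureTheory ProbabilityTheory Matrix InnerProductSpace ComplexConjugate ContinuousMap
open Filter Set Function TopologicalSpace MeasureTheory

attribute [summit_statement] _root_.YangMills

-- earlier TrajectoryThesis (stmt-QuantumFields-9173, replaced 2026-08-15T14:04:06Z -> stmt-QuantumFields-9613): retired by None — ContinuumLimitOnTrajectory ∧ LatticeGapOnTrajectory ∧ TunedSequenceExists
-- earlier TrajectoryThesis (stmt-QuantumFields-9613, replaced 2026-08-15T16:17:52Z -> stmt-QuantumFields-10525): retired by None — (∀ (G : Type) [Group G] [TopologicalSpace G] [IsTopologicalGroup G] [CompactSpace G], Literature.MathematicalPhysics.QuantumFieldTheory.IsCompactSimpleLieGroup G → letI : MeasurableSpace G := borel G; haveI : BorelSpace G := ⟨rfl⟩; ∀ (r : Literature.MathematicalPhysics.Q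
/-- item stmt-QuantumFields-10525 · target · rank 0 · open · by planner
why it might fail: X=(A)∧(B)∧(S) at rev 4 (β_k→∞ in all three): (A) is the open UV existence+uniqueness of YM₄, (B) the IR gap at weak coupling, (S) an open correlator lower bound (quantitative ξ(β)→∞); X fails if any conjunct does.
sources: JaffeWitten2000, Rivasseau1991, Balaban1988Convergent, arXiv:cond-mat/0306362, Literature.MathematicalPhysics.QuantumFieldTheory.LatticeMassGapAllCouplings, Literature.Barriers.QuantumFields.UVStabilityNonUniqueness
[target] X = (A) ∧ (B) ∧ (S) as in § Thesis — the literal conjunction of the rev-4 bodies of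
ContinuumLimitOnTrajectory, LatticeGapOnTrajectory, TunedSequenceExists (β_k → ∞ clause in each);
`TrajectoryThesis ↔ ContinuumLimitOnTrajectory ∧ LatticeGapOnTrajectory ∧ TunedSequenceExists` is
Iff.rfl (Sketch.lean `target_iff`). -/
@[route_item "route-QuantumFields-ParabolicTrajectory"]
def TrajectoryThesis : Prop :=
  (∀ (G : Type) [Group G] [TopologicalSpace G] [IsTopologicalGroup G] [CompactSpace G], Literature.MathematicalPhysics.QuantumFieldTheory.IsCompactSimpleLieGroup G → letI : MeasurableSpace G := borel G; haveI : BorelSpace G := ⟨rfl⟩; ∀ (r : Literature.MathematicalPhysics.QuantumFieldTheory.LatticeRep G), ∃ M₀ : ℕ, ∀ M : ℕ, M₀ ≤ M → 2 ≤ M → ∃ θ₀ : ℝ, 0 < θ₀ ∧ ∀ (θ Δ : ℝ) (sch : Literature.MathematicalPhysics.QuantumFieldTheory.SpeciesScheme (Literature.MathematicalPhysics.QuantumFieldTheory.YMSpecies G)) (n : ℕ → ℕ), 0 < θ → θ < θ₀ → 0 < Δ → (∀ k, sch.a k = ((M : ℝ) ^ n k)⁻¹) → Filter.Tendsto sch.β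 Filter.atTop Filter.atTop → (∀ t : ℕ, 0 < t → ∃ c : ℝ, Filter.Tendsto (fun k => ((M : ℝ) ^ n k) ^ 8 * Literature.MathematicalPhysics.QuantumFieldTheory.latticeConnectedCorr r.ρ (sch.β k) (sch.side k) r.curvature.F r.curvature.F (t * M ^ n k)) Filter.atTop (nhds c)) → Filter.Tendsto (fun k => ((M : ℝ) ^ n k) ^ 8 * Literature.MathematicalPhysics.QuantumFieldTheory.latticeConnectedCorr r.ρ (sch.β k) (sch.side k) r.curvature.F r.curvature.F (M ^ n k)) Filter.atTop (nhds θ) → Literature.MathematicalPhysics.QuantumFieldTheory.HasLatticeMassGap r sch Δ → ∃ sch' : Literature.MathematicalPhysics.QuantumFieldTheory.SpeciesScheme (Literature.MathematicalPhysics.QuantumFieldTheory.YMSpecies G), sch'.a = sch.a ∧ sch'.β = sch.β ∧ sch'.L = sch.L ∧ ∃ T : Literature.MathematicalPhysics.QuantumFieldTheory.OSData (Literature.MathematicalPhysics.QuantumFieldTheory.YMSpecies G) 4, Literature.MathematicalPhysics.QuantumFieldTheory.IsYangMillsFor r sch' T ∧ T.IsNontrivial r.curvature ∧ T.IsNonGaussian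 r.curvature) ∧ (∀ (G : Type) [Group G] [TopologicalSpace G] [IsTopologicalGroup G] [CompactSpace G], Literature.MathematicalPhysics.QuantumFieldTheory.IsCompactSimpleLieGroup G → letI : MeasurableSpace G := borel G; haveI : BorelSpace G := ⟨rfl⟩; ∀ (r : Literature.MathematicalPhysics.QuantumFieldTheory.LatticeRep G) (M : ℕ) (θ : ℝ) (sch : Literature.MathematicalPhysics.QuantumFieldTheory.SpeciesScheme (Literature.MathematicalPhysics.QuantumFieldTheory.YMSpecies G)) (n : ℕ → ℕ), 2 ≤ M → 0 < θ → (∀ k, sch.a k = ((M : ℝ) ^ n k)⁻¹) → Filter.Tendsto sch.β Filter.atTop Filter.atTop → Filter.Tendsto (fun k => ((M : ℝ) ^ n k) ^ 8 * Literature.MathematicalPhysics.QuantumFieldTheory.latticeConnectedCorr r.ρ (sch.β k) (sch.side k) r.curvature.F r.curvature.F (M ^ n k)) Filter.atTop (nhds θ) → ∃ Δ : ℝ, 0 < Δ ∧ Literature.MathematicalPhysics.QuantumFieldTheory.HasLatticeMassGap r sch Δ ∧ ∀ sch' : Literature.MathematicalPhysics.QuantumFieldTheory.SpeciesScheme (Literature.MathematicalPhysics.QuantumFieldTheory.YMSpecies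 G), sch'.a = sch.a → sch'.β = sch.β → sch'.L = sch.L → ∀ T : Literature.MathematicalPhysics.QuantumFieldTheory.OSData (Literature.MathematicalPhysics.QuantumFieldTheory.YMSpecies G) 4, Literature.MathematicalPhysics.QuantumFieldTheory.IsYangMillsFor r sch' T → T.HasMassGap Δ) ∧ (∀ (G : Type) [Group G] [TopologicalSpace G] [IsTopologicalGroup G] [CompactSpace G], Literature.MathematicalPhysics.QuantumFieldTheory.IsCompactSimpleLieGroup G → letI : MeasurableSpace G := borel G; haveI : BorelSpace G := ⟨rfl⟩; ∀ (r : Literature.MathematicalPhysics.QuantumFieldTheory.LatticeRep G) (M : ℕ), 2 ≤ M → ∃ θ₀ : ℝ, 0 < θ₀ ∧ ∀ θ : ℝ, 0 < θ → θ < θ₀ → ∃ (sch : Literature.MathematicalPhysics.QuantumFieldTheory.SpeciesScheme (Literature.MathematicalPhysics.QuantumFieldTheory.YMSpecies G)) (n : ℕ → ℕ), (∀ k, sch.a k = ((M : ℝ) ^ n k)⁻¹) ∧ Filter.Tendsto sch.β Filter.atTop Filter.atTop ∧ (∀ t : ℕ, 0 < t → ∃ c : ℝ, Filter.Tendsto (fun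 k => ((M : ℝ) ^ n k) ^ 8 * Literature.MathematicalPhysics.QuantumFieldTheory.latticeConnectedCorr r.ρ (sch.β k) (sch.side k) r.curvature.F r.curvature.F (t * M ^ n k)) Filter.atTop (nhds c)) ∧ Filter.Tendsto (fun k => ((M : ℝ) ^ n k) ^ 8 * Literature.MathematicalPhysics.QuantumFieldTheory.latticeConnectedCorr r.ρ (sch.β k) (sch.side k) r.curvature.F r.curvature.F (M ^ n k)) Filter.atTop (nhds θ))

-- earlier ContinuumLimitOnTrajectory (stmt-QuantumFields-9174, replaced 2026-08-15T16:17:52Z -> stmt-QuantumFields-10522): retired by None — ∀ (G : Type) [Group G] [TopologicalSpace G] [IsTopologicalGroup G] [CompactSpace G], Literature.MathematicalPhysics.QuantumFieldTheory.IsCompactSimpleLieGroup G → letI : MeasurableSpace G := borel G; haveI : BorelSpace G := ⟨rfl⟩; ∀ (r : Literature.Mathematical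
/-- item stmt-QuantumFields-10522 · crux · rank 2 · open · by planner
why it might fail: Open UV existence+uniqueness of YM₄ (Bałaban CMP119 Cor.3 stops at stability): needs his full step as a Lipschitz map, E1/E0' for tr F² limits, injective scale setting t ↦ lim N_t. Rev 4 adds β_k→∞, removing the finite-β parasites (bulk 1st-order / critical endpoint, reducible r).
sources: Balaban1988Convergent, Balaban1989LargeFieldII, Dimock2013, Rivasseau1991, Literature.Barriers.QuantumFields.UVStabilityNonUniqueness, arXiv:cond-mat/0306362
[crux] (A) of the thesis, repaired at rev 4 (2026-08-15: clause `Tendsto sch.β atTop atTop` added):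
for every compact simple G, lattice representation r, M ≥ M₀: ∃ θ₀ > 0 such that every M-adic (a_k =
M^(−n_k)) Wilson scheme with β_k → ∞ whose dimensionless curvature two-point functions N_t(k)
converge for all t ≥ 1 with lim N_1 = θ ∈ (0, θ₀), and which has HasLatticeMassGap r sch Δ (Δ > 0),
admits renormalisations (same a, β, L) and OS data T with IsYangMillsFor r sch' T, T.IsNontrivial
r.curvature, T.IsNonGaussian r.curvature (card items 1–4: Bałaban step as a Lipschitz parabolic map
→ centre-unstable curve → λ-lemma → observable flow). β_k → ∞ (bare coupling → 0: the limit is taken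
at the asymptotically free fixed point) excludes the parasitic tunings at finite β recorded by
retriage and refuter g41-25 (bulk first-order transition, van Enter–Shlosman arXiv:cond-mat/0306362
Thm 2; Bhanot–Creutz critical endpoint for reducible r, doi:10.1103/physrevd.24.3212) without
touching the thesis. [deps: BalabanStepParabolic, ParabolicCentreCurve] [difficulty: open-problem] -/
@[route_item "route-QuantumFields-ParabolicTrajectory", crux]
def ContinuumLimitOnTrajectory : Prop :=
  ∀ (G : Type) [Group G] [TopologicalSpace G] [IsTopologicalGroup G] [CompactSpace G], Literature.MathematicalPhysics.QuantumFieldTheory.IsCompactSimpleLieGroup G → letI : MeasurableSpace G := borel G; haveI : BorelSpace G := ⟨rfl⟩; ∀ (r : Literature.MathematicalPhysics.QuantumFieldTheory.LatticeRep G), ∃ M₀ : ℕ, ∀ M : ℕ, M₀ ≤ M → 2 ≤ M → ∃ θ₀ : ℝ, 0 < θ₀ ∧ ∀ (θ Δ : ℝ) (sch : Literature.MathematicalPhysics.QuantumFieldTheory.SpeciesScheme (Literature.MathematicalPhysics.QuantumFieldTheory.YMSpecies G)) (n : ℕ → ℕ), 0 < θ → θ < θ₀ → 0 < Δ → (∀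 k, sch.a k = ((M : ℝ) ^ n k)⁻¹) → Filter.Tendsto sch.β Filter.atTop Filter.atTop → (∀ t : ℕ, 0 < t → ∃ c : ℝ, Filter.Tendsto (fun k => ((M : ℝ) ^ n k) ^ 8 * Literature.MathematicalPhysics.QuantumFieldTheory.latticeConnectedCorr r.ρ (sch.β k) (sch.side k) r.curvature.F r.curvature.F (t * M ^ n k)) Filter.atTop (nhds c)) → Filter.Tendsto (fun k => ((M : ℝ) ^ n k) ^ 8 * Literature.MathematicalPhysics.QuantumFieldTheory.latticeConnectedCorr r.ρ (sch.β k) (sch.side k) r.curvature.F r.curvature.F (M ^ n k)) Filter.atTop (nhds θ) → Literature.MathematicalPhysics.QuantumFieldTheory.HasLatticeMassGap r sch Δ → ∃ sch' : Literature.MathematicalPhysics.QuantumFieldTheory.SpeciesScheme (Literature.MathematicalPhysics.QuantumFieldTheory.YMSpecies G), sch'.a = sch.a ∧ sch'.β = sch.β ∧ sch'.L = sch.L ∧ ∃ T : Literature.MathematicalPhysics.QuantumFieldTheory.OSData (Literature.MathematicalPhysics.QuantumFieldTheory.YMSpecies G) 4, Literature.MathematicalPhysics.QuantumFieldTheory.IsYangMillsFor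 r sch' T ∧ T.IsNontrivial r.curvature ∧ T.IsNonGaussian r.curvature

-- earlier LatticeGapOnTrajectory (stmt-QuantumFields-9176, replaced 2026-08-15T16:17:52Z -> stmt-QuantumFields-10523): retired by None — ∀ (G : Type) [Group G] [TopologicalSpace G] [IsTopologicalGroup G] [CompactSpace G], Literature.MathematicalPhysics.QuantumFieldTheory.IsCompactSimpleLieGroup G → letI : MeasurableSpace G := borel G; haveI : BorelSpace G := ⟨rfl⟩; ∀ (r : Literature.MathematicalPhys
/-- item stmt-QuantumFields-10523 · crux · rank 5 · open · by planner
why it might fail: Contains the IR mass gap for weak-coupling (β_k→∞) tuned Wilson sequences, all compact simple G: nothing rigorous beyond strong coupling (OS78; ξ(β)→∞ open, Chatterjee Pb 5.1); transfer clause needs clustering constants uniform over smeared products. Finite-β rounding-tail witness excluded at rev 4.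
sources: OsterwalderSeiler1978, Literature.MathematicalPhysics.QuantumFieldTheory.LatticeMassGapAllCouplings, ChatterjeeYMProb2019, JaffeWitten2000, GlimmJaffe1987, Literature.Barriers.QuantumFields.PerturbativeInvisibility
[crux] (B) of the thesis, repaired at rev 4 (β_k → ∞ added): for every compact simple G, r, M ≥ 2, θ
> 0 and every M-adic Wilson scheme with β_k → ∞ and lim_k a_k^(−8)⟨P; τ_(1/a_k) P⟩ = θ there is Δ >
0 with HasLatticeMassGap r sch Δ, and every T with IsYangMillsFor r sch' T (sch' = sch up to species
renormalisations) has T.HasMassGap Δ. The junction with the IR cards (twisted-tube,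
finite-size-criterion, curvature-closer); in this line's language the unstable curve continues as a
heteroclinic orbit into the high-temperature basin of the Haar fixed point. The β_k → ∞ clause
removes the fast-torus rounding-tail counterexample at a bulk first-order transition (covariance θ
a_k⁸ ≫ C e^{−Δ a_k L_k}). [difficulty: open-problem] -/
@[route_item "route-QuantumFields-ParabolicTrajectory", crux]
def LatticeGapOnTrajectory : Prop :=
  ∀ (G : Type) [Group G] [TopologicalSpace G] [IsTopologicalGroup G] [CompactSpace G], Literature.MathematicalPhysics.QuantumFieldTheory.IsCompactSimpleLieGroup G → letI : MeasurableSpace G := borel G; haveI : BorelSpace G := ⟨rfl⟩; ∀ (r : Literature.MathematicalPhysics.QuantumFieldTheory.LatticeRep G) (M : ℕ) (θ : ℝ) (sch : Literature.MathematicalPhysics.QuantumFieldTheory.SpeciesScheme (Literature.MathematicalPhysics.QuantumFieldTheory.YMSpecies G)) (n : ℕ → ℕ), 2 ≤ M → 0 < θ → (∀ k, sch.a k = ((M : ℝ) ^ n k)⁻¹) → Filter.Tendsto sch.β Filter.atTop Filter.atTop → Filter.Tendsto (fun k => ((M : ℝ) ^ n k) ^ 8 * Literature.MathematicalPhysics.QuantumFieldTheory.latticeConnectedCorr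 r.ρ (sch.β k) (sch.side k) r.curvature.F r.curvature.F (M ^ n k)) Filter.atTop (nhds θ) → ∃ Δ : ℝ, 0 < Δ ∧ Literature.MathematicalPhysics.QuantumFieldTheory.HasLatticeMassGap r sch Δ ∧ ∀ sch' : Literature.MathematicalPhysics.QuantumFieldTheory.SpeciesScheme (Literature.MathematicalPhysics.QuantumFieldTheory.YMSpecies G), sch'.a = sch.a → sch'.β = sch.β → sch'.L = sch.L → ∀ T : Literature.MathematicalPhysics.QuantumFieldTheory.OSData (Literature.MathematicalPhysics.QuantumFieldTheory.YMSpecies G) 4, Literature.MathematicalPhysics.QuantumFieldTheory.IsYangMillsFor r sch' T → T.HasMassGap Δ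

-- earlier TunedSequenceExists (stmt-QuantumFields-9177, replaced 2026-08-15T16:17:52Z -> stmt-QuantumFields-10524): retired by None — ∀ (G : Type) [Group G] [TopologicalSpace G] [IsTopologicalGroup G] [CompactSpace G], Literature.MathematicalPhysics.QuantumFieldTheory.IsCompactSimpleLieGroup G → letI : MeasurableSpace G := borel G; haveI : BorelSpace G := ⟨rfl⟩; ∀ (r : Literature.MathematicalPhysics
/-- item stmt-QuantumFields-10524 · crux · rank 9 · open · by planner
why it might fail: Needs a correlator LOWER bound sup_{β≥B} D⁸⟨P;τ_D P⟩_β ≥ θ₀ for all large D and every B — a quantitative ξ(β)→∞ (Chatterjee Pb 5.1), not in print; IVT/compactness/RP-monotonicity are routine. With β_k→∞ demanded a finite-β lattice critical point is no witness.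
sources: Literature.MathematicalPhysics.QuantumFieldTheory.LatticeMassGapAllCouplings, ChatterjeeYMProb2019, OsterwalderSeiler1978, Literature.Barriers.QuantumFields.FixedCouplingUltralocality, Literature.Barriers.QuantumFields.UVStabilityNonUniqueness, MontvayMunster1994
[crux] (S), repaired at rev 4 (β_k → ∞ added): for every compact simple G, r, M ≥ 2 there is θ₀ > 0
such that for every θ ∈ (0, θ₀) some M-adic Wilson scheme with β_k → ∞ has all N_t(k) convergent and
N_1(k) → θ. Intended proof: diagonal compactness (0 ≤ N_t ≤ N_1 by RP monotonicity), continuity of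
finite-torus correlators in β, N_1(k, β) → 0 as β → ∞ at fixed k (concentration on flat connections)
for the IVT on [B_k, ∞) with B_k → ∞; the one non-elementary input is the correlator LOWER bound
sup_{β ≥ B} N_1(k, β) ≥ θ₀ for all large k and every B — a quantitative form of ξ(β) → ∞ (Chatterjee
Pb 5.1), which refuters g41-8/g41-25 and grounder g18-7 rate open rather than M. [difficulty:
L/open] -/
@[route_item "route-QuantumFields-ParabolicTrajectory", crux]
def TunedSequenceExists : Prop :=
  ∀ (G : Type) [Group G] [TopologicalSpace G] [IsTopologicalGroup G] [CompactSpace G], Literature.MathematicalPhysics.QuantumFieldTheory.IsCompactSimpleLieGroup G → letI : MeasurableSpace G := borel G; haveI : BorelSpace G := ⟨rfl⟩; ∀ (r : Literature.MathematicalPhysics.QuantumFieldTheory.LatticeRep G) (M : ℕ), 2 ≤ M → ∃ θ₀ : ℝ, 0 < θ₀ ∧ ∀ θ : ℝ, 0 < θ → θ < θ₀ → ∃ (sch : Literature.MathematicalPhysics.QuantumFieldTheory.SpeciesScheme (Literature.MathematicalPhysics.QuantumFieldTheory.YMSpecies G)) (n : ℕ → ℕ), (∀ k, sch.a k = ((M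 : ℝ) ^ n k)⁻¹) ∧ Filter.Tendsto sch.β Filter.atTop Filter.atTop ∧ (∀ t : ℕ, 0 < t → ∃ c : ℝ, Filter.Tendsto (fun k => ((M : ℝ) ^ n k) ^ 8 * Literature.MathematicalPhysics.QuantumFieldTheory.latticeConnectedCorr r.ρ (sch.β k) (sch.side k) r.curvature.F r.curvature.F (t * M ^ n k)) Filter.atTop (nhds c)) ∧ Filter.Tendsto (fun k => ((M : ℝ) ^ n k) ^ 8 * Literature.MathematicalPhysics.QuantumFieldTheory.latticeConnectedCorr r.ρ (sch.β k) (sch.side k) r.curvature.F r.curvature.F (M ^ n k)) Filter.atTop (nhds θ)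

/-- item stmt-QuantumFields-9684 · support · rank 3 · open · by planner
why it might fail: Not load-bearing (outside the closes cone) and misstated as typed: even M junk-inhabited (Negative.nonempty_of_even); odd M ⇔ RG-free over-tuned triviality UOT (Negative.nonempty_iff_uniformOverTuned); false modulo FaceContactHypothesis. Held, negative record only.
sources: Balaban1987RG1, Balaban1988Convergent, Balaban1989LargeFieldII, Dimock2013, doi:10.1007/s002200050474, BauerschmidtBrydgesSlade2019RG
[crux] BalabanStepParabolic (card items 1+2, the technical heart; first child of
ContinuumLimitOnTrajectory in the two-layer plan). For every compact simple G, faithful unitary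
lattice representation r and block factor M ≥ M₀(G, r) there is a real Banach space E of quasi-local
gauge-invariant irrelevant action functionals on unit-lattice gauge fields (vacuum energy quotiented
out) and coordinates (g, y) ∈ [0, δ] × E ↦ effective Gibbs factor in which ONE complete Bałaban
renormalisation transformation (gauge-covariant averaging of CMP 98, small-field analytic expansion
plus large-field R-operation of CMP 109/116/122, rescaling to the unit lattice) acts as a map F(g,
y) = (φ(g, y), Ψ(g, y)) satisfying the hypothesis block of ParabolicCentreCurve: φ(g, y) = g + b g³
+ O(g⁴ + g³‖y‖) with b = b₀(G)·log M > 0, b₀(G) = 11·C₂(G)/(48π²) for the Killing-normalised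
coupling (one loop, uniform in G; asymptotic freedom = repelling side), Ψ(g, y) = A y + O(g² + ‖y‖²)
with ‖A‖ ≤ θ < 1 (irrelevant directions; renorming allowed), all remainders Lipschitz as in
ParabolicCentreCurve INCLUDING the large-field contributions (size exp(−p(g)²), required
o(g³)-Lipschitz in g); moreover (a) Wilson's action -/
@[route_item "route-QuantumFields-ParabolicTrajectory"]
def BalabanStepParabolic : Prop :=
  ∀ (G : Type) [Group G] [TopologicalSpace G] [IsTopologicalGroup G] [CompactSpace G], Literature.MathematicalPhysics.QuantumFieldTheory.IsCompactSimpleLieGroup G → letI : MeasurableSpace G := borel G; haveI : BorelSpace G := ⟨rfl⟩; ∀ (r : Literature.MathematicalPhysics.QuantumFieldTheory.LatticeRep G), ∃ M₀ : ℕ, ∀ M : ℕ, M₀ ≤ M → Nonempty (Literature.MathematicalPhysics.QuantumFieldTheory.BalabanBanachStep G r M)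

/-- item stmt-QuantumFields-9175 · support · rank 4 · closed · proved by Summit.QuantumFields.YangMills.Theorems.parabolicCentreCurve_proof @ 2142c112ca10 (prover) · by planner
why it might fail: pure Banach-space dynamics, believed true; can fail only through the exact hypotheses — uniqueness among merely continuous graphs, or a chart-boundary edge effect in the attraction clause (invariance used at φ(g, h g) slightly beyond δ'); then restate, not close.
sources: doi:10.1007/bfb0092042, doi:10.3934/dcds.2007.17.835, doi:10.1016/j.jde.2019.11.100
[crux] abstract dynamics (card item 3, typed over Mathlib): on ℝ × E, E a real Banach space, a map
F(g, y) = (g + b g³ + ρ₁, A y + ρ₂) with b > 0, ‖A‖ ≤ θ < 1 and explicit Lipschitz remainder bounds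
(ρ₁ = O(g⁴ + g³‖y‖), ∂_y ρ₁ = O(g³), ρ₂ = O(g² + ‖y‖²), …) has, on some [0, δ'], a continuous
invariant graph y = h(g) with h(0) = 0, ‖h(g)‖ ≤ C'g² (the centre-unstable curve on the repelling
side), UNIQUE among continuous invariant graphs through 0 staying in the chart, and exponentially
attracting: every orbit segment staying in the chart satisfies ‖y_k − h(g_k)‖ ≤ K θ₁^k ‖y_0 −
h(g_0)‖ with θ₁ < 1. [difficulty: L] -/
@[route_item "route-QuantumFields-ParabolicTrajectory"]
def ParabolicCentreCurve : Prop :=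
  ∀ (E : Type) [NormedAddCommGroup E] [NormedSpace ℝ E] [CompleteSpace E] (φ : ℝ → E → ℝ) (Ψ : ℝ → E → E) (A : E →L[ℝ] E) (b θ C δ : ℝ), 0 < b → 0 ≤ θ → θ < 1 → 0 < C → 0 < δ → ‖A‖ ≤ θ → (∀ g : ℝ, ∀ y : E, |g| ≤ δ → ‖y‖ ≤ δ → |φ g y - (g + b * g ^ 3)| ≤ C * (g ^ 4 + |g| ^ 3 * ‖y‖) ∧ ‖Ψ g y - A y‖ ≤ C * (g ^ 2 + ‖y‖ ^ 2)) → (∀ g : ℝ, ∀ y y' : E, |g| ≤ δ → ‖y‖ ≤ δ → ‖y'‖ ≤ δ → |φ g y - φ g y'| ≤ C * |g| ^ 3 * ‖y - y'‖ ∧ ‖Ψ g y - Ψ g y' - A (y - y')‖ ≤ C * (|g| + ‖y‖ + ‖y'‖) * ‖y - y'‖) → (∀ g g' : ℝ, ∀ y : E, |g| ≤ δ → |g'| ≤ δ → ‖y‖ ≤ δ → |φ g y - φ g' y - (g - g') - b * (g ^ 3 - g' ^ 3)| ≤ C * (max |g| |g'|) ^ 2 * (max |g| |g'| + ‖y‖)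 * |g - g'| ∧ ‖Ψ g y - Ψ g' y‖ ≤ C * (|g| + |g'| + ‖y‖) * |g - g'|) → ∃ (δ' K θ₁ C' : ℝ) (h : ℝ → E), 0 < δ' ∧ δ' ≤ δ ∧ 0 ≤ θ₁ ∧ θ₁ < 1 ∧ ContinuousOn h (Set.Icc 0 δ') ∧ h 0 = 0 ∧ (∀ g ∈ Set.Icc 0 δ', ‖h g‖ ≤ C' * g ^ 2) ∧ (∀ g ∈ Set.Icc 0 δ', φ g (h g) ≤ δ' → Ψ g (h g) = h (φ g (h g))) ∧ (∀ h' : ℝ → E, ContinuousOn h' (Set.Icc 0 δ') → h' 0 = 0 → (∀ g ∈ Set.Icc 0 δ', ‖h' g‖ ≤ δ') → (∀ g ∈ Set.Icc 0 δ', φ g (h' g) ≤ δ' → Ψ g (h' g) = h' (φ g (h' g))) → ∀ g ∈ Set.Icc 0 δ', h' g = h g) ∧ (∀ (p : ℝ × E) (k : ℕ), (∀ j ≤ k, ((fun q : ℝ × E => (φ q.1 q.2, Ψ q.1 q.2))^[j] p).1 ∈ Set.Icc 0 δ' ∧ ‖((fun q : ℝ × E => (φ q.1 q.2, Ψ q.1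 q.2))^[j] p).2‖ ≤ δ') → ‖((fun q : ℝ × E => (φ q.1 q.2, Ψ q.1 q.2))^[k] p).2 - h ((fun q : ℝ × E => (φ q.1 q.2, Ψ q.1 q.2))^[k] p).1‖ ≤ K * θ₁ ^ k * ‖p.2 - h p.1‖)

-- `ParabolicCentreCurve` holds: proved by `Summit.QuantumFields.YangMills.Theorems.parabolicCentreCurve_proof` @ 2142c112ca10 (its module imports this route file, so no `_holds` link can be stated here).

/-- item stmt-QuantumFields-9178 · assembly · rank 1 · closed · proved by Summit.QuantumFields.YangMills.Theorems.Assembly_proof @ d40345d45b7c (prover) · by planner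
sources: JaffeWitten2000, OsterwalderSchrader1975
[assembly] ContinuumLimitOnTrajectory → LatticeGapOnTrajectory → TunedSequenceExists → YangMills. -/
@[route_item "route-QuantumFields-ParabolicTrajectory"]
def Assembly : Prop :=
  ContinuumLimitOnTrajectory → LatticeGapOnTrajectory → TunedSequenceExists → YangMills

-- `Assembly` holds: proved by `Summit.QuantumFields.YangMills.Theorems.Assembly_proof` @ d40345d45b7c (its module imports this route file, so no `_holds` link can be stated here).

/-! D-0027 §2.1 — DECIDING THEOREM (planner-authored via `route open/edit --closes-file`; by planner-rrepair-QuantumFields-ParabolicTraject-7a12a637-0 2026-08-16T17:35:53Z):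
its hypotheses are this route's items and its conclusion the sub-problem Statement (glue_lint), and it elaborates with this file. -/

@[closes "route-QuantumFields-ParabolicTrajectory"] theorem closes : ContinuumLimitOnTrajectory → LatticeGapOnTrajectory → TunedSequenceExists → YangMills := by
  intro hA hB hS G _ _ _ _ hG
  obtain ⟨r⟩ := hG.2
  letI : MeasurableSpace G := borel G
  haveI : BorelSpace G := ⟨rfl⟩
  obtain ⟨M₀, hM₀⟩ := hA G hG r
  have hM2 : 2 ≤ max M₀ 2 := le_max_right _ _
  obtain ⟨θ₀, hθ₀, hA'⟩ := hM₀ (max M₀ 2) (le_max_left _ _) hM2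
  obtain ⟨θ₁, hθ₁, hS'⟩ := hS G hG r (max M₀ 2) hM2
  have hθpos : 0 < min θ₀ θ₁ / 2 := by positivity
  have hθlt₀ : min θ₀ θ₁ / 2 < θ₀ := by have := min_le_left θ₀ θ₁; linarith
  have hθlt₁ : min θ₀ θ₁ / 2 < θ₁ := by have := min_le_right θ₀ θ₁; linarith
  obtain ⟨sch, n, hshape, hbeta, hconv, htune⟩ := hS' (min θ₀ θ₁ / 2) hθpos hθlt₁
  obtain ⟨Δ, hΔ, hgap, htransfer⟩ :=
    hB G hG r (max M₀ 2) (min θ₀ θ₁ / 2) sch n hM2 hθpos hshape hbeta htune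
  obtain ⟨sch', ha, hβ, hL, T, hYM, hNT, hNG⟩ :=
    hA' (min θ₀ θ₁ / 2) Δ sch n hθpos hθlt₀ hΔ hshape hbeta hconv htune hgap
  -- statement re-type 2026-08-16 (p116790): the weak-coupling conjunct `sch'.HasWeakCouplingLimit`
  -- (:= Tendsto sch'.β atTop atTop) is the β_k → ∞ clause that (S) already delivers for `sch`
  -- (rev 4), transported along the species renormalisation `sch'.β = sch.β` given by (A).
  have hweak : sch'.HasWeakCouplingLimit := by
    show Filter.Tendsto sch'.β Filter.atTop Filter.atTop
    rw [hβ]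
    exact hbeta
  refine ⟨r, sch', T, hweak, hYM, hNT, hNG, Δ, hΔ, htransfer sch' ha hβ hL T hYM, ?_⟩
  intro A B
  obtain ⟨C, hC⟩ := hgap A B
  refine ⟨C, ?_⟩
  simpa only [ha, hβ, hL] using hC

end Summit.QuantumFields.YangMills.Theses.ParabolicTrajectory
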